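import Literature.NumberTheory.GaloisRepresentations.GalLayerSystemFreePresentationVanishing
import Literature.Algebra.Homology.DiscreteRepCoindPresentation
import Literature.Algebra.Homology.DiscreteRepContinuous
import Literature.NumberTheory.GaloisRepresentations.AbsGaloisGroupCompact
import HarnessLib

/-!
# The canonical free presentation of a finite discrete Galois module at the layer cut out by its kernel

Topic `NumberTheory/GaloisRepresentations`; namespace `Literature.NumberTheory.GaloisRepresentations.FreePresentation`.
Definitions with bodies and theorems; no named fact, no instance, no `sorry`.  Sequel to
`GalLayerSystemFreePresentationVanishing` (`presLattice E₀ m = Inf ℤ[Γ/U_{E₀}]ᵐ`) and door-c4's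
`DiscreteRepFreePresentation` (`freePresentation_shortExact`).

For a finite discrete Galois module `ρ` on `M` over a number field `K`:
* `kerOpenNormalSubgroup ρ` — the kernel `ker ρ ≤ Γ_K` is an OPEN normal subgroup (it contains an open normal subgroup
  fixing the finitely many elements of `M`, door-c4's `exists_openNormalSubgroup_forall_apply_eq`);
* `presentationLayer ρ = K̄^{ker ρ} = K(M)`, the finite Galois layer with `U_{K(M)} = ker ρ`
  (door-c5's dictionary `GalLayer.ofOpenNormalSubgroup`);
* `presentationComplex ρ : 0 → N₁ → presLattice (K(M)) |M| → M → 0`, door-c4's free presentation on ALL elements of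
  `M` as generators, SHORT EXACT (`presentationComplex_shortExact`), with `X₂ = presLattice …` and
  `X₃ = ofDiscreteGaloisModule ρ` DEFINITIONALLY, and `U_{K(M)}` acting trivially on `N₁` (`presentationComplex_X₁_trivial`).
This is the presentation `S` fed to `middleExact_allPlaces_of_readout` (door-c6 g16 presentation road); the choice
`U₀ = ker ρ` is what makes the inertia bridge `HomDual.galUnr_le_stabilizer_of_isUnramifiedAt` applicable
(`ker ρ` fixes the index set `Fin m × Γ/U₀` of the permuted basis: `smul_eq_of_apply_eq_one`).

References: Milne, *Arithmetic Duality Theorems* I Lemma 1.9 (proof); Harari, *Galois Cohomology and Class Field Theory* §4.3.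
-/

noncomputable section

open CategoryTheory CategoryTheory.Limits
open Field (absoluteGaloisGroup)
open Literature.Algebra.Homology Literature.Algebra.Homology.DiscreteRep

namespace Literature.NumberTheory.GaloisRepresentations

open IdeleClassBar

namespace FreePresentation

variable {K : Type} [Field K] [NumberField K]
variable {M : Type} [AddCommGroup M] [TopologicalSpace M] [DiscreteTopology M] [Finite M]
variable (ρ : DiscreteGaloisModule K M)

/-! ## §1 The kernel of a finite discrete Galois module is an open normal subgroup -/

/-- **`ker ρ ≤ Γ_K` as an open normal subgroup** (finite `M`: some open normal subgroup fixes `M` pointwise).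
[cite: MilneADT2006, I Lemma 1.9 (proof)] [cite: Harari2020, §4.3, Remark 4.15] -/
def kerOpenNormalSubgroup : OpenNormalSubgroup (absoluteGaloisGroup K) where
  toSubgroup := ρ.toRepresentation.ker
  isOpen' := by
    haveI := absoluteGaloisGroup_compactSpace K
    haveI : TotallyDisconnectedSpace (absoluteGaloisGroup K) := inferInstance
    obtain ⟨U, hU⟩ := exists_openNormalSubgroup_forall_apply_eq (k := ℤ) (ofDiscreteGaloisModule ρ)
    refine Subgroup.isOpen_mono (H₁ := (U : Subgroup (absoluteGaloisGroup K))) (fun u hu => ?_)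
      (LayerColimit.coe_isOpen U)
    exact (MonoidHom.mem_ker).2 (LinearMap.ext fun x => hU u hu x)

omit [NumberField K] in
/-- Membership: `γ ∈ ker ρ ↔ ρ γ = 1`. [cite: MilneADT2006, I Lemma 1.9 (proof)] -/
theorem mem_kerOpenNormalSubgroup_iff (γ : absoluteGaloisGroup K) :
    γ ∈ (kerOpenNormalSubgroup ρ : Subgroup (absoluteGaloisGroup K)) ↔ ρ.toRepresentation γ = 1 :=
  MonoidHom.mem_ker

omit [NumberField K] in
/-- `γ ∈ ker ρ` acts trivially on `M`. [cite: MilneADT2006, I Lemma 1.9 (proof)] -/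
theorem apply_eq_of_mem_kerOpenNormalSubgroup {γ : absoluteGaloisGroup K}
    (hγ : γ ∈ (kerOpenNormalSubgroup ρ : Subgroup (absoluteGaloisGroup K))) (x : M) : ρ γ x = x := by
  have h := LinearMap.congr_fun ((mem_kerOpenNormalSubgroup_iff ρ γ).1 hγ) x
  exact h

/-! ## §2 The layer `K(M) = K̄^{ker ρ}` -/

/-- **The splitting layer `K(M) = K̄^{ker ρ}` of `ρ`** (a finite Galois layer with `U_{K(M)} = ker ρ`).
[cite: MilneADT2006, I Lemma 1.9 (proof)] -/
def presentationLayer : GalLayer K := GalLayer.ofOpenNormalSubgroup (kerOpenNormalSubgroup ρ)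

/-- `U_{K(M)} = ker ρ`. [cite: MilneADT2006, I Lemma 1.9 (proof)] -/
@[simp] theorem presentationLayer_openNormalSubgroup :
    (presentationLayer ρ).openNormalSubgroup = kerOpenNormalSubgroup ρ :=
  GalLayer.openNormalSubgroup_ofOpenNormalSubgroup _

/-- Membership: `γ ∈ U_{K(M)} ↔ ρ γ = 1`. [cite: MilneADT2006, I Lemma 1.9 (proof)] -/
theorem mem_presentationLayer_iff (γ : absoluteGaloisGroup K) :
    γ ∈ ((presentationLayer ρ).openNormalSubgroup : Subgroup (absoluteGaloisGroup K)) ↔ ρ.toRepresentation γ = 1 := by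
  rw [presentationLayer_openNormalSubgroup, mem_kerOpenNormalSubgroup_iff]

/-- `U_{K(M)}` acts trivially on `M`. [cite: MilneADT2006, I Lemma 1.9 (proof)] -/
theorem apply_eq_of_mem_presentationLayer {γ : absoluteGaloisGroup K}
    (hγ : γ ∈ ((presentationLayer ρ).openNormalSubgroup : Subgroup (absoluteGaloisGroup K))) (x : M) : ρ γ x = x :=
  apply_eq_of_mem_kerOpenNormalSubgroup ρ (by rwa [presentationLayer_openNormalSubgroup] at hγ) x

/-- **`ker ρ` fixes the cosets `Γ/U_{K(M)}`** (so it fixes the index set of the permuted basis of `presLattice`):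
`ρ γ = 1 ⟹ γ · q = q`. [cite: MilneADT2006, I Lemma 1.9 (proof)] -/
theorem smul_eq_of_apply_eq_one {γ : absoluteGaloisGroup K} (hγ : ρ.toRepresentation γ = 1)
    (q : absoluteGaloisGroup K ⧸ ((presentationLayer ρ).openNormalSubgroup : Subgroup (absoluteGaloisGroup K))) :
    γ • q = q := by
  induction q using QuotientGroup.induction_on with
  | H τ =>
    rw [show γ • (QuotientGroup.mk τ : absoluteGaloisGroup K ⧸
        ((presentationLayer ρ).openNormalSubgroup : Subgroup (absoluteGaloisGroup K))) = QuotientGroup.mk (γ * τ) from rfl,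
      QuotientGroup.eq, mul_inv_rev]
    exact Subgroup.Normal.conj_mem' inferInstance γ⁻¹ (inv_mem ((mem_presentationLayer_iff ρ γ).2 hγ)) τ

/-! ## §3 The presentation `0 → N₁ → presLattice (K(M)) |M| → M → 0` -/

/-- The rank of the presentation: the number of elements of `M`. [cite: MilneADT2006, I Lemma 1.9 (proof)] -/
def presentationRank (_ρ : DiscreteGaloisModule K M) : ℕ := Nat.card M

/-- **The generators: ALL elements of `M`**, as `U_{K(M)}`-invariants of `ofDiscreteGaloisModule ρ`.
[cite: MilneADT2006, I Lemma 1.9 (proof)] -/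
def presentationGens :
    Fin (presentationRank ρ) →
      ((invariantsQuotFunctor ℤ ((presentationLayer ρ).openNormalSubgroup : Subgroup (absoluteGaloisGroup K))).obj
        (ofDiscreteGaloisModule ρ)).V :=
  fun i => ⟨(Nat.equivFinOfCardPos (α := M) (Nat.card_pos (α := M)).ne').symm i,
    (Representation.mem_invariants _ _).2 fun u => apply_eq_of_mem_presentationLayer ρ u.2 _⟩

/-- The generators span (every invariant is one of them). [cite: MilneADT2006, I Lemma 1.9 (proof)] -/
theorem span_presentationGens : Submodule.span ℤ (Set.range (presentationGens ρ)) = ⊤ := by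
  rw [eq_top_iff]
  rintro ⟨x, hx⟩ -
  refine Submodule.subset_span ⟨Nat.equivFinOfCardPos (α := M) (Nat.card_pos (α := M)).ne' x, ?_⟩
  exact Subtype.ext (by simp [presentationGens])

/-- The surjection `presLattice (K(M)) |M| ⟶ M` of the presentation (door-c4's `freePresentationHom` on all elements).
[cite: MilneADT2006, I Lemma 1.9 (proof)] -/
def presentationHom : presLattice (presentationLayer ρ) (presentationRank ρ) ⟶ ofDiscreteGaloisModule ρ :=
  freePresentationHom ((presentationLayer ρ).openNormalSubgroup : Subgroup (absoluteGaloisGroup K))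
    (LayerColimit.coe_isOpen (presentationLayer ρ).openNormalSubgroup) (ofDiscreteGaloisModule ρ) (presentationGens ρ)

/-- **The presentation complex `0 → N₁ → presLattice (K(M)) |M| → M → 0`** (`N₁ = ker`). [cite: MilneADT2006, I Lemma 1.9 (proof)] -/
def presentationComplex : ShortComplex (DiscreteRepCat ℤ (absoluteGaloisGroup K)) :=
  ShortComplex.mk (kernel.ι (presentationHom ρ)) (presentationHom ρ) (kernel.condition _)

/-- `X₂` of the presentation is `presLattice (K(M)) |M|` (definitionally). [cite: MilneADT2006, I Lemma 1.9 (proof)] -/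
theorem presentationComplex_X₂ :
    (presentationComplex ρ).X₂ = presLattice (presentationLayer ρ) (presentationRank ρ) := rfl

/-- `X₃` of the presentation is `ofDiscreteGaloisModule ρ` (definitionally). [cite: MilneADT2006, I Lemma 1.9 (proof)] -/
theorem presentationComplex_X₃ : (presentationComplex ρ).X₃ = ofDiscreteGaloisModule ρ := rfl

/-- `g` of the presentation is `presentationHom` (definitionally). [cite: MilneADT2006, I Lemma 1.9 (proof)] -/
theorem presentationComplex_g : (presentationComplex ρ).g = presentationHom ρ := rfl

/-- **The presentation is short exact.** [cite: MilneADT2006, I Lemma 1.9 (proof)] -/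
theorem presentationComplex_shortExact : (presentationComplex ρ).ShortExact :=
  freePresentation_shortExact ((presentationLayer ρ).openNormalSubgroup : Subgroup (absoluteGaloisGroup K))
    (LayerColimit.coe_isOpen (presentationLayer ρ).openNormalSubgroup) (ofDiscreteGaloisModule ρ) (presentationGens ρ)
    (span_presentationGens ρ) (fun _ hu x => apply_eq_of_mem_presentationLayer ρ hu x)

/-- `S.f = kernel.ι` is injective on vectors. [cite: MilneADT2006, I Lemma 1.9 (proof)] -/
theorem presentationComplex_f_injective : Function.Injective (presentationComplex ρ).f.hom.hom :=
  (Rep.mono_iff_injective ((DiscreteRep.ι ℤ (absoluteGaloisGroup K)).map (presentationComplex ρ).f)).1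
    (by
      haveI := (presentationComplex_shortExact ρ).mono_f
      infer_instance)

/-- **`U_{K(M)} = ker ρ` acts trivially on the kernel `N₁`** (a subobject of the `U_{K(M)}`-trivial `presLattice`).
[cite: MilneADT2006, I Lemma 1.9 (proof)] -/
theorem presentationComplex_X₁_trivial :
    ∀ σ ∈ (presentationLayer ρ).openNormalSubgroup, ∀ x : (presentationComplex ρ).X₁.obj.V,
      (presentationComplex ρ).X₁.obj.ρ σ x = x := fun σ hσ x => by
  apply presentationComplex_f_injective ρ
  rw [Rep.hom_comm_apply]
  exact trivialOn_presLattice (presentationLayer ρ) (presentationRank ρ) σ hσ _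

/-- `U_{K(M)}` acts trivially on `X₃ = M`. [cite: MilneADT2006, I Lemma 1.9 (proof)] -/
theorem presentationComplex_X₃_trivial :
    ∀ σ ∈ (presentationLayer ρ).openNormalSubgroup, ∀ x : (presentationComplex ρ).X₃.obj.V,
      (presentationComplex ρ).X₃.obj.ρ σ x = x := fun _ hσ x =>
  apply_eq_of_mem_presentationLayer ρ hσ x

end FreePresentation

end Literature.NumberTheory.GaloisRepresentations

end
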